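import Literature.Probability.LatticeModels.StarLattice
import Mathlib.Data.Pi.Interval
import HarnessLib

/-!
# Lemma B.81 inside a box: the `★`-triangles of a box generate its even `★`-edge sets

Topic `Literature/Probability/LatticeModels`. `StarLattice.lean` proves Friedli–Velenik's Lemma B.81
in the box form `inSpan_starTriangles_of_peelInv`: an even set of `★`-edges with all endpoints in a
coordinate box `Λ = ∏ⱼ [aⱼ, bⱼ]` is a sum modulo 2 of `★`-triangles — of the whole lattice `ℤ^{d★}`,
as far as the STATEMENT goes (the peeling only ever uses triangles of the box, but its conclusion is
`InSpan (starTriangles d)`). Here the conclusion is sharpened to the family of `★`-triangles WITH ALL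
THREE VERTICES IN `Λ` (`inSpan_starTriangles_box`), i.e. the `★`-triangles of the box generate the
cycle space of the `★`-graph induced on the box — the input of Lemma B.83 for that induced graph
(`StarBoundaryBox.lean`). Proof: push a triangle decomposition forward along the coordinatewise CLAMP
`π : ℤ^d → Λ`, `π(x)ⱼ = max(aⱼ, min(xⱼ, bⱼ))`, a retraction onto `Λ` that is `1`-Lipschitz for
`‖·‖_∞`; modulo 2, `π` maps a `★`-triangle either to a `★`-triangle of `Λ` or to zero, fixes every
`★`-edge of `Λ`, and commutes with symmetric differences (`𝔽₂`-pushforward = `Finset.fold symmDiff`).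

* private helpers `fold_symmDiff_symmDiff`, `InSpan.fold_symmDiff`, `fold_symmDiff_eq_self` (the
  `𝔽₂`-pushforward of edge sets along an edge map and its additivity), `symmDiff_pairs_three` (the image
  of a triangle: a triangle or zero), `exists_boxClamp` (the clamp retraction);
* `inSpan_starTriangles_box`, `inSpan_starTriangles_box_of_peelInv` — Lemma B.81 for the box family.

Everything is proved; no named facts and no new definitions (the box family is written
`{T ∈ starTriangles d | ∀ e ∈ T, ∀ x ∈ e, x ∈ Finset.Icc a b}`).

## References

* S. Friedli, Y. Velenik, *Statistical Mechanics of Lattice Systems*, CUP 2017, App. B.15,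
  Lemma B.81 (and its use in Lemma B.82 for subsets of a box, §7.2.6). [FriedliVelenik2017]
* Á. Timár, Proc. AMS 141 (2013) 475–480, Theorem 3 (generating sets of the cycle space of a
  subgraph). [Timar2013]
-/

open Finset SimpleGraph
open Literature.Combinatorics.SimpleGraph.CycleSpace

namespace Literature.Probability.LatticeModels

/-! ### The `𝔽₂`-pushforward of a finite edge set along an edge map -/

section Push

variable {ι γ : Type*} [DecidableEq ι] [DecidableEq γ]

/-- **Additivity of the `𝔽₂`-pushforward.** For `f : ι → Finset γ`, the map
`Z ↦ ∆_{e ∈ Z} f e` (`Finset.fold symmDiff ∅ f`) turns symmetric differences into symmetric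
differences. [folklore] -/
private theorem fold_symmDiff_symmDiff (f : ι → Finset γ) (s t : Finset ι) :
    Finset.fold symmDiff ∅ f (symmDiff s t) =
      symmDiff (Finset.fold symmDiff ∅ f s) (Finset.fold symmDiff ∅ f t) := by
  have hdisj : Disjoint (symmDiff s t) (s ∩ t) := by
    rw [Finset.disjoint_left]
    intro e he hst
    rw [Finset.mem_symmDiff] at he
    rw [Finset.mem_inter] at hst
    tauto
  have hunion : s ∪ t = (symmDiff s t).disjUnion (s ∩ t) hdisj := by
    ext e
    simp only [Finset.mem_union, Finset.disjUnion_eq_union, Finset.mem_symmDiff, Finset.mem_inter]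
    tauto
  have h1 := Finset.fold_union_inter (op := symmDiff) (f := f) (s₁ := s) (s₂ := t)
    (b₁ := (∅ : Finset γ)) (b₂ := (∅ : Finset γ))
  have h3 := Finset.fold_disjUnion (op := symmDiff) (f := f) (b₁ := (∅ : Finset γ)) (b₂ := (∅ : Finset γ)) hdisj
  rw [symmDiff_self, Finset.bot_eq_empty] at h3
  have h2 : Finset.fold symmDiff (∅ : Finset γ) f (s ∪ t) =
      symmDiff (Finset.fold symmDiff ∅ f (symmDiff s t)) (Finset.fold symmDiff ∅ f (s ∩ t)) := by
    rw [hunion]; exact h3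
  rw [h2, symmDiff_assoc, symmDiff_self, symmDiff_bot] at h1
  exact h1

/-- **Pushing a span forward.** If every generator of `𝒞` is mapped by the `𝔽₂`-pushforward along
`f` to a member of `𝒟` or to zero, then the pushforward of every set in the span of `𝒞` is in the
span of `𝒟`. [folklore] -/
private theorem InSpan.fold_symmDiff {α' β' : Type*} [DecidableEq α'] [DecidableEq β']
    {𝒞 : Set (Finset (Sym2 α'))} {𝒟 : Set (Finset (Sym2 β'))} (f : Sym2 α' → Finset (Sym2 β'))
    (hf : ∀ C ∈ 𝒞, Finset.fold symmDiff ∅ f C ∈ 𝒟 ∨ Finset.fold symmDiff ∅ f C = ∅)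
    {Z : Finset (Sym2 α')} (hZ : InSpan 𝒞 Z) : InSpan 𝒟 (Finset.fold symmDiff ∅ f Z) := by
  induction hZ with
  | empty => rw [Finset.fold_empty]; exact InSpan.empty
  | @step C Z' hC _ ih =>
    rw [fold_symmDiff_symmDiff]
    rcases hf C hC with h | h
    · exact InSpan.step h ih
    · rw [h, bot_eq_empty.symm, bot_symmDiff]; exact ih

/-- A set on which `f` is the embedding `e ↦ {e}` is its own pushforward. [folklore] -/
private theorem fold_symmDiff_eq_self (f : ι → Finset ι) {Z : Finset ι} (hZ : ∀ e ∈ Z, f e = {e}) :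
    Finset.fold symmDiff ∅ f Z = Z := by
  induction Z using Finset.induction_on with
  | empty => exact Finset.fold_empty
  | insert e s hes ih =>
    rw [Finset.fold_insert hes, hZ e (Finset.mem_insert_self e s),
      ih fun e' he' => hZ e' (Finset.mem_insert_of_mem he')]
    rw [(Finset.disjoint_singleton_left.2 hes).symmDiff_eq_sup, sup_eq_union, insert_eq]

/-- **The image of a triangle**, modulo 2: for three points `p q r` the sum of the three "edges or
zero" `[p ≠ q]·{pq} ∆ [q ≠ r]·{qr} ∆ [p ≠ r]·{pr}` is the triangle `{pq, qr, pr}` when `p, q, r` are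
pairwise distinct and is zero otherwise. [folklore] -/
private theorem symmDiff_pairs_three (p q r : γ) :
    symmDiff (if p = q then (∅ : Finset (Sym2 γ)) else {s(p, q)})
      (symmDiff (if q = r then (∅ : Finset (Sym2 γ)) else {s(q, r)})
        (if p = r then (∅ : Finset (Sym2 γ)) else {s(p, r)})) =
      if p ≠ q ∧ q ≠ r ∧ p ≠ r then {s(p, q), s(q, r), s(p, r)} else ∅ := by
  have e0 : ∀ X : Finset (Sym2 γ), symmDiff X X = ∅ := fun X => by rw [symmDiff_self, Finset.bot_eq_empty]
  have e1 : ∀ X : Finset (Sym2 γ), symmDiff ∅ X = X := fun X => by rw [← Finset.bot_eq_empty, bot_symmDiff]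
  have e2 : ∀ X : Finset (Sym2 γ), symmDiff X ∅ = X := fun X => by rw [← Finset.bot_eq_empty, symmDiff_bot]
  by_cases hpq : p = q
  · subst hpq
    by_cases hpr : p = r
    · subst hpr
      simp
    · simp [hpr]
  by_cases hqr : q = r
  · subst hqr
    simp [hpq, e1]
  by_cases hpr : p = r
  · subst hpr
    have hsw : s(q, p) = s(p, q) := Sym2.eq_swap
    simp [hpq, hqr, e2, hsw]
  rw [if_neg hpq, if_neg hqr, if_neg hpr, if_pos ⟨hpq, hqr, hpr⟩]
  have h1 : s(q, r) ≠ s(p, r) := by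
    intro h
    rcases Sym2.eq_iff.1 h with ⟨h, -⟩ | ⟨h, -⟩
    · exact hpq h.symm
    · exact hqr h
  have h2 : s(p, q) ∉ ({s(q, r), s(p, r)} : Finset (Sym2 γ)) := by
    simp only [Finset.mem_insert, Finset.mem_singleton, not_or]
    refine ⟨fun h => ?_, fun h => ?_⟩
    · rcases Sym2.eq_iff.1 h with ⟨h, -⟩ | ⟨h, -⟩
      · exact hpq h
      · exact hpr h
    · rcases Sym2.eq_iff.1 h with ⟨-, h⟩ | ⟨h, -⟩
      · exact hqr h
      · exact hpr h
  rw [(Finset.disjoint_singleton_left.2 (Finset.notMem_singleton.2 h1)).symmDiff_eq_sup, sup_eq_union,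
    ← insert_eq, (Finset.disjoint_singleton_left.2 h2).symmDiff_eq_sup, sup_eq_union, ← insert_eq]

end Push

/-! ### The clamp retraction onto a box -/

variable {d : ℕ}

/-- **The clamp.** For a non-empty coordinate box `Λ = Icc a b` of `ℤ^d`, the coordinatewise clamp
`xⱼ ↦ max(aⱼ, min(xⱼ, bⱼ))` maps `ℤ^d` into `Λ`, fixes `Λ` pointwise, and does not increase the
sup-distance (it is `1`-Lipschitz in every coordinate). [folklore] -/
private theorem exists_boxClamp {a b : Site d} (hab : a ≤ b) :
    ∃ π : Site d → Site d, (∀ x, π x ∈ Finset.Icc a b) ∧ (∀ x ∈ Finset.Icc a b, π x = x) ∧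
      ∀ x y, supDist (π x) (π y) ≤ supDist x y := by
  refine ⟨fun x j => max (a j) (min (x j) (b j)), fun x => ?_, fun x hx => ?_, fun x y => ?_⟩
  · rw [Finset.mem_Icc]
    refine ⟨fun j => le_max_left _ _, fun j => max_le (hab j) (min_le_right _ _)⟩
  · rw [Finset.mem_Icc] at hx
    funext j
    have h1 := hx.1 j; have h2 := hx.2 j
    show max (a j) (min (x j) (b j)) = x j
    rw [min_eq_left h2, max_eq_right h1]
  · rw [supDist_le_iff]
    intro j
    have h := natAbs_sub_le_supDist x y j
    have key : (max (a j) (min (x j) (b j)) - max (a j) (min (y j) (b j))).natAbs ≤ (x j - y j).natAbs := by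
      omega
    show (max (a j) (min (x j) (b j)) - max (a j) (min (y j) (b j))).natAbs ≤ supDist x y
    exact key.trans h

/-! ### Lemma B.81 for the box family -/

/-- **Lemma B.81 (Friedli–Velenik 2017), box family.** An even set `Z` of `★`-edges with all
endpoints in the coordinate box `∏ⱼ [a j, b j]` (the peeling invariant `PeelInv a b Z`) is a sum
modulo 2 of `★`-triangles WITH ALL VERTICES IN THE BOX. Proof: by `inSpan_starTriangles_of_peelInv`,
`Z` is a sum of `★`-triangles of `ℤ^d`; push this decomposition forward along the clamp `π` onto the
box: modulo 2 the image of a `★`-triangle `xyz` is the `★`-triangle `π(x)π(y)π(z)` of the box if these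
three points are distinct (they are pairwise at sup-distance `≤ 1`) and zero otherwise, while every
edge of `Z` is fixed. [cite: FriedliVelenik2017, App. B.15, Lemma B.81; Timar2013, Theorem 3] -/
theorem inSpan_starTriangles_box_of_peelInv {a b : Site d} {Z : Finset (Sym2 (Site d))}
    (hZ : PeelInv a b Z) :
    InSpan {T | T ∈ starTriangles d ∧ ∀ e ∈ T, ∀ x ∈ e, x ∈ Finset.Icc a b} Z := by
  classical
  -- the empty set is trivial; otherwise the box is non-empty
  rcases Z.eq_empty_or_nonempty with rfl | ⟨e₀, he₀⟩
  · exact InSpan.empty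
  have hab : a ≤ b := by
    induction e₀ using Sym2.ind with
    | h x y =>
      intro j
      have := hZ.box _ he₀ x (Sym2.mem_mk_left x y) j
      exact this.1.trans this.2
  obtain ⟨π, hπbox, hπid, hπlip⟩ := exists_boxClamp hab
  have hmemIcc : ∀ x : Site d, x ∈ Finset.Icc a b ↔ ∀ j, a j ≤ x j ∧ x j ≤ b j := by
    intro x
    rw [Finset.mem_Icc]
    exact ⟨fun h j => ⟨h.1 j, h.2 j⟩, fun h => ⟨fun j => (h j).1, fun j => (h j).2⟩⟩
  -- the pushforward along `π`
  set f : Sym2 (Site d) → Finset (Sym2 (Site d)) :=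
    fun e => if (Sym2.map π e).IsDiag then ∅ else {Sym2.map π e} with hf
  have hfmk : ∀ x y : Site d, f s(x, y) = if π x = π y then ∅ else {s(π x, π y)} := by
    intro x y
    simp only [hf, Sym2.map_mk, Sym2.mk_isDiag_iff]
  -- the image of a `★`-triangle is a box triangle or zero
  have htri : ∀ C ∈ starTriangles d,
      Finset.fold symmDiff ∅ f C ∈ {T | T ∈ starTriangles d ∧ ∀ e ∈ T, ∀ x ∈ e, x ∈ Finset.Icc a b} ∨
        Finset.fold symmDiff ∅ f C = ∅ := by
    rintro C ⟨x, y, z, hxy, hyz, hxz, rfl⟩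
    have hne1 : s(y, z) ≠ s(x, z) := by
      intro h
      rcases Sym2.eq_iff.1 h with ⟨h, -⟩ | ⟨h, -⟩
      · exact hxy.ne h.symm
      · exact hyz.ne h
    have hne2 : s(x, y) ∉ ({s(y, z), s(x, z)} : Finset (Sym2 (Site d))) := by
      simp only [Finset.mem_insert, Finset.mem_singleton, not_or]
      refine ⟨fun h => ?_, fun h => ?_⟩
      · rcases Sym2.eq_iff.1 h with ⟨h, -⟩ | ⟨h, -⟩
        · exact hxy.ne h
        · exact hxz.ne h
      · rcases Sym2.eq_iff.1 h with ⟨-, h⟩ | ⟨h, -⟩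
        · exact hyz.ne h
        · exact hxz.ne h
    have hfold : Finset.fold symmDiff (∅ : Finset (Sym2 (Site d))) f {s(x, y), s(y, z), s(x, z)} =
        symmDiff (f s(x, y)) (symmDiff (f s(y, z)) (f s(x, z))) := by
      rw [Finset.fold_insert hne2, Finset.fold_insert (Finset.notMem_singleton.2 hne1), Finset.fold_singleton,
        ← Finset.bot_eq_empty, symmDiff_bot]
    rw [hfold, hfmk, hfmk, hfmk, symmDiff_pairs_three]
    by_cases hdist : π x ≠ π y ∧ π y ≠ π z ∧ π x ≠ π z
    · left
      rw [if_pos hdist]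
      have hadj : ∀ u v : Site d, (zdStar d).Adj u v → π u ≠ π v → (zdStar d).Adj (π u) (π v) :=
        fun u v huv hne => zdStar_adj.2 ⟨hne, (hπlip u v).trans (zdStar_adj.1 huv).2⟩
      refine ⟨triangle_mem_starTriangles (hadj x y hxy hdist.1) (hadj y z hyz hdist.2.1) (hadj x z hxz hdist.2.2),
        fun e he w hw => ?_⟩
      rcases mem_triangle_iff.1 he with rfl | rfl | rfl <;>
        rcases Sym2.mem_iff.1 hw with rfl | rfl <;> exact hπbox _
    · right; rw [if_neg hdist]
  -- push the triangle decomposition of `Z` forward; `Z` itself is fixed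
  have hspan := InSpan.fold_symmDiff f htri (inSpan_starTriangles_of_peelInv _ a b Z hZ le_rfl)
  rwa [fold_symmDiff_eq_self f] at hspan
  intro e he
  induction e using Sym2.ind with
  | h x y =>
    have hx : π x = x := hπid x ((hmemIcc x).2 (hZ.box _ he x (Sym2.mem_mk_left x y)))
    have hy : π y = y := hπid y ((hmemIcc y).2 (hZ.box _ he y (Sym2.mem_mk_right x y)))
    have hne : x ≠ y := by
      have := hZ.edge _ he
      rw [SimpleGraph.mem_edgeSet] at this
      exact this.ne
    rw [hfmk, hx, hy, if_neg hne]

/-- **Lemma B.81, box family, stated on the edge set.** An even set of `★`-edges whose endpoints all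
lie in the box `Icc a b` is a sum modulo 2 of `★`-triangles with vertices in `Icc a b`: the
`★`-triangles of a box generate the cycle space of the `★`-graph induced on the box.
[cite: FriedliVelenik2017, App. B.15, Lemma B.81; Timar2013, Theorem 3] -/
theorem inSpan_starTriangles_box {a b : Site d} {Z : Finset (Sym2 (Site d))}
    (hedge : ∀ e ∈ Z, e ∈ (zdStar d).edgeSet) (heven : IsEvenEdgeSet Z)
    (hbox : ∀ e ∈ Z, ∀ x ∈ e, x ∈ Finset.Icc a b) :
    InSpan {T | T ∈ starTriangles d ∧ ∀ e ∈ T, ∀ x ∈ e, x ∈ Finset.Icc a b} Z := by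
  refine inSpan_starTriangles_box_of_peelInv ⟨hedge, heven, fun e he x hx j => ?_⟩
  have h := Finset.mem_Icc.1 (hbox e he x hx)
  exact ⟨h.1 j, h.2 j⟩

/-- The box family consists of even sets of `★`-edges with endpoints in the box (the side conditions
of Lemma B.83 for this family). [cite: FriedliVelenik2017, App. B.15] -/
theorem starTriangles_box_even_edge {a b : Site d} {T : Finset (Sym2 (Site d))}
    (hT : T ∈ {T | T ∈ starTriangles d ∧ ∀ e ∈ T, ∀ x ∈ e, x ∈ Finset.Icc a b}) :
    IsEvenEdgeSet T ∧ ∀ e ∈ T, e ∈ (zdStar d).edgeSet ∧ ∀ x ∈ e, x ∈ Finset.Icc a b :=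
  ⟨isEvenEdgeSet_of_mem_starTriangles hT.1, fun e he =>
    ⟨mem_edgeSet_of_mem_starTriangles hT.1 he, hT.2 e he⟩⟩

end Literature.Probability.LatticeModels
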